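import Summits.AtomisticToContinuum.Crystallization.Theorems.ChargedEnergyGapHarmonicTransferA
import HarnessLib

/-!
# «HarmonicTransfer» (lens-3 g53 P-A, line 14231 ChargedEnergyGap) — part B (sequel of `…ChargedEnergyGapHarmonicTransferA`)
LANDING BANNER (critic row 1115 (6); landing lane hand-2 g31): the (H𝄪)/(N𝄪)-type RECORD pieces of this lens-3 g53–g56 engine are VACUOUS at μ₀ > 0 — `harmStableWith_nonpos` (lens-3 g61, `…ChargedEnergyGapRotationGauge`); superseded by the …R designate ((H𝄪ʳ) `LocalSeamTransferBoundR`, (N𝄪ʳ) `LocalSeamReductionR` of `…ChargedEnergyGapRotationRepair`).  Landed as an ENGINE: the transfer / reduction lemmas below are consumed by P-I.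

Split for the 400-line cap by the landing lane (hand-2 g29); the module docstring of part A describes the whole node.  Same namespace; all FQNs unchanged.
0 sorry; standard axioms.
-/

noncomputable section
open scoped Classical
open Literature.MathematicalPhysics.StatisticalMechanics
open Literature.Geometry.DiscreteGeometry
open Summit.AtomisticToContinuum.Crystallization.Theses.PricedLinkCensus
open Summit.AtomisticToContinuum.Crystallization.Theorems.ChargedEnergyGapNegative

namespace Summit.AtomisticToContinuum.Crystallization.Theorems.ChargedEnergyGapChartDial

/-! ## §2 Admissible data, the two pieces, dials, glue, WEAKER -/

section Pieces

/-- The reference is `s`-SEPARATED. -/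
def IsSeparatedRef (s : ℝ) (P : PeriodicConfiguration 3) : Prop :=
  ∀ y ∈ P.points, ∀ z ∈ P.points, y ≠ z → s ≤ dist y z

/-- The reference is BARLOW-LABELLED within `ℓ` at strain `lam` around every motif site (`LabelledWithin`, part N-A). -/
def IsLabelledRef (lam ℓ : ℝ) (P : PeriodicConfiguration 3) : Prop :=
  ∀ y ∈ P.motif, LabelledWithin lam ℓ P y

/-- FORCE EQUILIBRIUM of the reference: `Σ'_{z ≠ y} (V′(d_yz)/d_yz)·(z − y) = 0` at every motif site. -/
def IsForceFree (P : PeriodicConfiguration 3) : Prop :=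
  ∀ y ∈ P.motif, (∑' z : {z : E3 // z ∈ P.points ∧ z ≠ y}, (ljD1 (dist y z) / dist y (z : E3)) • ((z : E3) - y)) = 0

/-- STRESS EQUILIBRIUM of the reference (zero virial tensor per cell): `Σ_{y ∈ motif} Σ'_{z ≠ y} (V′(d)/d)⟪z − y, a⟫⟪z − y, b⟫ = 0`. -/
def IsStressFree (P : PeriodicConfiguration 3) : Prop :=
  ∀ a b : E3, (∑ y ∈ P.motif, ∑' z : {z : E3 // z ∈ P.points ∧ z ≠ y},
    ljD1 (dist y z) / dist y (z : E3) * (inner ℝ ((z : E3) - y) a * inner ℝ ((z : E3) - y) b)) = 0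

/-- `Λ_P`-PERIODIC vector field. -/
def IsPeriodicField (P : PeriodicConfiguration 3) (u : E3 → E3) : Prop :=
  ∀ g ∈ P.lattice, ∀ q : E3, u (q + g) = u q

/-- `Λ_P`-INVARIANT set. -/
def IsInvariantSet (P : PeriodicConfiguration 3) (C : Set E3) : Prop :=
  ∀ g ∈ P.lattice, ∀ q : E3, q + g ∈ C ↔ q ∈ C

/-- GLOBAL BOND COCYCLE: antisymmetric, `Λ_P`-periodic, additive on ALL triples of sites — exactly the bond fields `δu + A` of an
affine-plus-`Λ_P`-periodic displacement (homogeneous strain `A` included); the test objects of (H♭) and of the stability margin.  (A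
cocycle additive only on SHORT non-excised triangles leaves its long bonds free, and the attractive tail then pays per plateau site:
memo g53 §1 dead end 10 — monodromy is deliberately NOT admitted.) -/
def IsGlobalCocycle (P : PeriodicConfiguration 3) (β : E3 → E3 → E3) : Prop :=
  (∀ y ∈ P.points, ∀ z ∈ P.points, β z y = -β y z) ∧
  (∀ g ∈ P.lattice, ∀ y z : E3, β (y + g) (z + g) = β y z) ∧
  (∀ y ∈ P.points, ∀ z ∈ P.points, ∀ x ∈ P.points, β y z + β z x = β y x)

/-- HARMONIC STABILITY WITH MARGIN `μ₀` over global cocycles: for every affine-plus-periodic bond field the cell's quadratic term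
dominates `μ₀ ×` the cell's nearest-neighbour-range Dirichlet term (phonon AND elastic stability in one hypothesis — a Bravais reference
has no non-trivial periodic field, so periodic stability alone would be vacuous and admit elastically unstable zero-stress lattices;
fcc Lennard-Jones at zero stress: `μ₀ ≈ 0.019`, softest `[110]` shear / its affine limit, memo g53 §2). -/
def HarmStableWith (μ₀ : ℝ) (P : PeriodicConfiguration 3) : Prop :=
  ∀ β : E3 → E3 → E3, IsGlobalCocycle P β →
    μ₀ * (∑ y ∈ P.motif, dirichletSite β P y) ≤ ∑ y ∈ P.motif, quadSite β P ∅ y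

/-- SMALL BOND STRAIN `τ` on EVERY non-excised pair (all distances: a pair with no short non-excised chain between its ends is still
constrained, so no remnant carries a free displacement). -/
def SmallStrain (τ : ℝ) (P : PeriodicConfiguration 3) (X : Set E3) (β : E3 → E3 → E3) : Prop :=
  ∀ y ∈ P.points, ∀ z ∈ P.points, y ∉ X → z ∉ X → ‖β y z‖ ≤ τ * dist y z

variable (s lam ℓ μ₀ τ lamQ ϱ C_T : ℝ)

/-- piece HARM-TRANSFER♭(`C_T`) · UNDECIDED→TRUE-leaning at the record · INSTRUMENTABLE via (H) · ATTACKABLE-M.  **THE HARMONIC TRANSFER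
BOUND FOR BOND COCYCLES**: some `C_H ≥ 0` such that for every `s`-separated, Barlow-labelled reference `P` in force and stress
equilibrium with stability margin `μ₀` over global cocycles, every `Λ_P`-invariant centre set `C` and excised set `X`, and every global
bond cocycle `β` (affine-plus-periodic bond field) of strain `≤ τ` on non-excised pairs, the profile-weighted harmonic model of the far
account is
at least `−C_T·(model shell count) − C_H·(priced excised count)`.  Why it might fail: a curved or creased shell geometry, a polytype
reference, a Bloch sector or a stability margin near `μ₀` not sampled in memo g53 §2 whose transfer optimum per shell site exceeds `C_T` (record
`1/(3·10⁶)`; census C11-29 `7.8·10⁻⁸/λ` per shell site, planar fcc (001) `3.85·10⁻⁸/λ`), or free core-zone excision slabs eating more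
than the estimated quarter of `C_T`. -/
def HarmonicTransferBoundC : Prop :=
  ∃ C_H : ℝ, 0 ≤ C_H ∧ ∀ (P : PeriodicConfiguration 3) (C X : Set E3) (β : E3 → E3 → E3),
    IsSeparatedRef s P → IsLabelledRef lam ℓ P → IsForceFree P → IsStressFree P → HarmStableWith μ₀ P →
    IsInvariantSet P C → IsInvariantSet P X → IsGlobalCocycle P β → SmallStrain τ P X β →
      -(C_T * (modelShellCount P X ϱ C : ℝ)) - C_H * (pricedExcisedCount P X ϱ C : ℝ) ≤ modelFar β P X lamQ ϱ C

/-- piece HARM-TRANSFER(`C_T`) · WEAKER than HARM-TRANSFER♭ (`harmonicTransferBound_of_cocycle`) · the census-facing KILL PATH (C10/C11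
are instances).  **THE HARMONIC TRANSFER BOUND FOR DISPLACEMENT FIELDS**: the same conclusion for the bond fields `δu` of
`Λ_P`-periodic displacements `u` of strain `≤ τ` on non-excised pairs. -/
def HarmonicTransferBound : Prop :=
  ∃ C_H : ℝ, 0 ≤ C_H ∧ ∀ (P : PeriodicConfiguration 3) (C X : Set E3) (u : E3 → E3),
    IsSeparatedRef s P → IsLabelledRef lam ℓ P → IsForceFree P → IsStressFree P → HarmStableWith μ₀ P →
    IsInvariantSet P C → IsInvariantSet P X → IsPeriodicField P u → SmallStrain τ P X (fieldCocycle u) →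
      -(C_T * (modelShellCount P X ϱ C : ℝ)) - C_H * (pricedExcisedCount P X ϱ C : ℝ) ≤ modelFar (fieldCocycle u) P X lamQ ϱ C

/-- The bond field of a `Λ_P`-periodic displacement is a global cocycle. -/
theorem isGlobalCocycle_fieldCocycle {P : PeriodicConfiguration 3} {u : E3 → E3} (hu : IsPeriodicField P u) :
    IsGlobalCocycle P (fieldCocycle u) := by
  refine ⟨fun y _ z _ => ?_, fun g hg y z => ?_, fun y _ z _ x _ => ?_⟩
  · simp only [fieldCocycle, neg_sub]
  · simp only [fieldCocycle, hu g hg y, hu g hg z]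
  · simp only [fieldCocycle, sub_add_sub_cancel']

variable {s lam ℓ μ₀ τ lamQ ϱ C_T}

/-- ★ WEAKER: HARM-TRANSFER♭ ⟹ HARM-TRANSFER (instantiate the cocycle at `δu`). -/
theorem harmonicTransferBound_of_cocycle (h : HarmonicTransferBoundC s lam ℓ μ₀ τ lamQ ϱ C_T) :
    HarmonicTransferBound s lam ℓ μ₀ τ lamQ ϱ C_T := by
  obtain ⟨C_H, hH, h⟩ := h
  exact ⟨C_H, hH, fun P C X u h1 h2 h3 h4 h5 h6 h7 h8 h9 =>
    h P C X (fieldCocycle u) h1 h2 h3 h4 h5 h6 h7 (isGlobalCocycle_fieldCocycle h8) h9⟩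

variable (s lam ℓ μ₀ τ lamQ ϱ C_T)
variable {θ ε R r η L δ L' : ℝ} (W : CoreWeights θ ε R r η L δ L' ϱ) (c₁ ρ₀ B₀ : ℝ)

/-- piece HARM-REDUCTION_W · WEAKER than CB-FAR_W|cored,`B₀` (`harmonicReductionW_of_budget`) · UNDECIDED (TRUE-leaning with the leaf for
the max cover) · ATTACKABLE-L (far regions that are one periodic Barlow polytype up to trivial-monodromy distortion, with priced holes) |
IDEA-NEEDED (dislocated sector; reference switching).  **THE HARMONIC REDUCTION**: the harmonic transfer bound for global bond cocycles
implies the budget far leaf.  Content (memo g53 §3): Taylor reduction of the clean far account to the model with the fraction `1 − λ` of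
the quadratic part absorbing the remainder at strain `τ` (bond-wise, not through the margin); the labelled far region charted on ONE
zero-stress polytype reference with an affine-plus-periodic displacement; sites of distortion between `τ` and `lam` paid by coercivity
on average; `ρ₀`-holes around gross matter as priced excisions paid by the neighbourhood debit `C₁`; core zones as free excisions;
profile deformation between reference and actual sites; creases.  Why it might fail: only with the leaf (it is implied by it) — as a
PROOF TASK it is open where the far region carries monodromy outside the core zones (dislocation lines, large loops, fault ribbons of
dissociated partials: cut surfaces with quantised jumps are not test objects of (H♭)) or switches reference (grains, twins). -/
def HarmonicReductionW : Prop :=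
  HarmonicTransferBoundC s lam ℓ μ₀ τ lamQ ϱ C_T → FarLabelledFloorCoredBudgetW W c₁ s ρ₀ lam ℓ B₀

variable {s lam ℓ μ₀ τ lamQ ϱ C_T W c₁ ρ₀ B₀}

/-- ★ **THE SPLIT** (glue, proved; bridge split by modus ponens): HARM-TRANSFER♭ ∧ HARM-REDUCTION_W ⟹ CB-FAR_W|cored,`B₀`. -/
theorem farLabelledFloorCoredBudgetW_of_harmonic (hH : HarmonicTransferBoundC s lam ℓ μ₀ τ lamQ ϱ C_T)
    (hN : HarmonicReductionW s lam ℓ μ₀ τ lamQ ϱ C_T W c₁ ρ₀ B₀) : FarLabelledFloorCoredBudgetW W c₁ s ρ₀ lam ℓ B₀ :=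
  hN hH

/-- WEAKER: the budget far leaf implies HARM-REDUCTION_W at every dial. -/
theorem harmonicReductionW_of_budget (h : FarLabelledFloorCoredBudgetW W c₁ s ρ₀ lam ℓ B₀) :
    HarmonicReductionW s lam ℓ μ₀ τ lamQ ϱ C_T W c₁ ρ₀ B₀ :=
  fun _ => h

/-- HARM-TRANSFER♭ is monotone in the transfer constant `C_T` … -/
theorem HarmonicTransferBoundC.mono_CT {C_T' : ℝ} (hC : C_T ≤ C_T') (h : HarmonicTransferBoundC s lam ℓ μ₀ τ lamQ ϱ C_T) :
    HarmonicTransferBoundC s lam ℓ μ₀ τ lamQ ϱ C_T' := by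
  obtain ⟨C_H, hH, h⟩ := h
  refine ⟨C_H, hH, fun P C X β h1 h2 h3 h4 h5 h6 h7 h8 h9 => ?_⟩
  have key := h P C X β h1 h2 h3 h4 h5 h6 h7 h8 h9
  have hm : C_T * (modelShellCount P X ϱ C : ℝ) ≤ C_T' * (modelShellCount P X ϱ C : ℝ) :=
    mul_le_mul_of_nonneg_right hC (Nat.cast_nonneg _)
  linarith

/-- … antitone in the strain amplitude `τ` (fewer test cocycles) … -/
theorem HarmonicTransferBoundC.anti_tau {τ' : ℝ} (hτ : τ' ≤ τ) (h : HarmonicTransferBoundC s lam ℓ μ₀ τ lamQ ϱ C_T) :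
    HarmonicTransferBoundC s lam ℓ μ₀ τ' lamQ ϱ C_T := by
  obtain ⟨C_H, hH, h⟩ := h
  refine ⟨C_H, hH, fun P C X β h1 h2 h3 h4 h5 h6 h7 h8 h9 => h P C X β h1 h2 h3 h4 h5 h6 h7 h8 ?_⟩
  intro y hy z hz hyX hzX
  exact (h9 y hy z hz hyX hzX).trans (mul_le_mul_of_nonneg_right hτ dist_nonneg)

/-- … monotone in the stability margin `μ₀` (fewer references) … -/
theorem HarmonicTransferBoundC.mono_mu {μ₀' : ℝ} (hμ : μ₀ ≤ μ₀') (h : HarmonicTransferBoundC s lam ℓ μ₀ τ lamQ ϱ C_T) :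
    HarmonicTransferBoundC s lam ℓ μ₀' τ lamQ ϱ C_T := by
  obtain ⟨C_H, hH, h⟩ := h
  refine ⟨C_H, hH, fun P C X β h1 h2 h3 h4 h5 h6 h7 h8 h9 => h P C X β h1 h2 h3 h4 ?_ h6 h7 h8 h9⟩
  intro γ hγ
  have h0 : 0 ≤ ∑ y ∈ P.motif, dirichletSite γ P y :=
    Finset.sum_nonneg fun y _ => tsum_nonneg fun _ => sq_nonneg _
  exact (mul_le_mul_of_nonneg_right hμ h0).trans (h5 γ hγ)

/-- … monotone in the separation `s` (fewer references) … -/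
theorem HarmonicTransferBoundC.mono_s {s' : ℝ} (hs : s ≤ s') (h : HarmonicTransferBoundC s lam ℓ μ₀ τ lamQ ϱ C_T) :
    HarmonicTransferBoundC s' lam ℓ μ₀ τ lamQ ϱ C_T := by
  obtain ⟨C_H, hH, h⟩ := h
  exact ⟨C_H, hH, fun P C X β h1 h2 h3 h4 h5 h6 h7 h8 h9 =>
    h P C X β (fun y hy z hz hne => hs.trans (h1 y hy z hz hne)) h2 h3 h4 h5 h6 h7 h8 h9⟩

/-- … and antitone in the labelling tolerance `lam` of the reference (fewer references). -/
theorem HarmonicTransferBoundC.anti_lam {lam' : ℝ} (hlam : lam' ≤ lam) (h : HarmonicTransferBoundC s lam ℓ μ₀ τ lamQ ϱ C_T) :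
    HarmonicTransferBoundC s lam' ℓ μ₀ τ lamQ ϱ C_T := by
  obtain ⟨C_H, hH, h⟩ := h
  exact ⟨C_H, hH, fun P C X β h1 h2 h3 h4 h5 h6 h7 h8 h9 =>
    h P C X β h1 (fun y hy => (h2 y hy).mono hlam) h3 h4 h5 h6 h7 h8 h9⟩

/-- The same dial in `C_T` for the displacement-field version. -/
theorem HarmonicTransferBound.mono_CT {C_T' : ℝ} (hC : C_T ≤ C_T') (h : HarmonicTransferBound s lam ℓ μ₀ τ lamQ ϱ C_T) :
    HarmonicTransferBound s lam ℓ μ₀ τ lamQ ϱ C_T' := by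
  obtain ⟨C_H, hH, h⟩ := h
  refine ⟨C_H, hH, fun P C X u h1 h2 h3 h4 h5 h6 h7 h8 h9 => ?_⟩
  have key := h P C X u h1 h2 h3 h4 h5 h6 h7 h8 h9
  have hm : C_T * (modelShellCount P X ϱ C : ℝ) ≤ C_T' * (modelShellCount P X ϱ C : ℝ) :=
    mul_le_mul_of_nonneg_right hC (Nat.cast_nonneg _)
  linarith

/-- HARM-REDUCTION_W is antitone in `C_T` … -/
theorem HarmonicReductionW.anti_CT {C_T' : ℝ} (hC : C_T' ≤ C_T) (h : HarmonicReductionW s lam ℓ μ₀ τ lamQ ϱ C_T W c₁ ρ₀ B₀) :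
    HarmonicReductionW s lam ℓ μ₀ τ lamQ ϱ C_T' W c₁ ρ₀ B₀ :=
  fun hH => h (hH.mono_CT hC)

/-- … monotone in the strain amplitude `τ` … -/
theorem HarmonicReductionW.mono_tau {τ' : ℝ} (hτ : τ ≤ τ') (h : HarmonicReductionW s lam ℓ μ₀ τ lamQ ϱ C_T W c₁ ρ₀ B₀) :
    HarmonicReductionW s lam ℓ μ₀ τ' lamQ ϱ C_T W c₁ ρ₀ B₀ :=
  fun hH => h (hH.anti_tau hτ)

/-- … antitone in the stability margin `μ₀` … -/
theorem HarmonicReductionW.anti_mu {μ₀' : ℝ} (hμ : μ₀' ≤ μ₀) (h : HarmonicReductionW s lam ℓ μ₀ τ lamQ ϱ C_T W c₁ ρ₀ B₀) :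
    HarmonicReductionW s lam ℓ μ₀' τ lamQ ϱ C_T W c₁ ρ₀ B₀ :=
  fun hH => h (hH.mono_mu hμ)

/-- … monotone in the slack `c₁` and antitone in the budget `B₀` (inherited from the leaf). -/
theorem HarmonicReductionW.mono_c {c₁' B₀' : ℝ} (hc : c₁ ≤ c₁') (hB : B₀' ≤ B₀)
    (h : HarmonicReductionW s lam ℓ μ₀ τ lamQ ϱ C_T W c₁ ρ₀ B₀) : HarmonicReductionW s lam ℓ μ₀ τ lamQ ϱ C_T W c₁' ρ₀ B₀' :=
  fun hH => ((h hH).mono W hc).anti W hB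

/-- The unsplit chain: HARM-TRANSFER♭ ∧ HARM-REDUCTION_W ∧ SHELL-BUDGET_W ⟹ CB-FAR_W|cored (parts O-D + P-A). -/
theorem farLabelledFloorCoredW_of_harmonic_shellBudget (hS : ShellBudgetW W s B₀)
    (hH : HarmonicTransferBoundC s lam ℓ μ₀ τ lamQ ϱ C_T) (hN : HarmonicReductionW s lam ℓ μ₀ τ lamQ ϱ C_T W c₁ ρ₀ B₀) :
    FarLabelledFloorCoredW W c₁ s ρ₀ lam ℓ :=
  farLabelledFloorCoredW_of_shellBudget W hS (farLabelledFloorCoredBudgetW_of_harmonic hH hN)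

end Pieces

/-! ## §3 The record dials `(μ₀, τ, λ, C_T) = (1/100, 3/100, 1/2, 1/(3·10⁶))` and ★★ the ten-leaf cones -/

section Record

/-- The record transfer constant spends two thirds of the far slack on the shell: `C_T·B₀ = 10⁵/(3·10⁶) = 1/30 = (2/3)·c₁` (the
remaining `c₁/3 = 1/60` per core is the reduction's). -/
theorem record_transfer_budget : (1 / 3000000 : ℝ) * 100000 = 2 / 3 * (1 / 20) := by norm_num

/-- The census-measured max-cover transfer optimum (C11-29: `−0.0058` per unit line length over `92 891` shell sites per unit length for
the hcp host, `× 1.25` for the full-range third moment ⇒ `7.8·10⁻⁸` per shell site at `λ = 1`, hence `1.56·10⁻⁷` at `λ = 1/2`) sits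
below the record `C_T = 1/(3·10⁶)` by the factor `> 2`; the planar fcc (001) harmonic optimum of memo g53 §2 is `3.85·10⁻⁸`. -/
theorem record_transfer_margin : 2 * (2 * (78 / 1000000000 : ℝ)) < 1 / 3000000 := by norm_num

/-- C11-29 in per-shell-site currency: `0.0058 / 92891 < 7·10⁻⁸` (truncated third moment; `× 1.25` full range). -/
theorem census_C11_per_shell_site : (58 / 10000 : ℝ) / 92891 < 7 / 100000000 := by norm_num

/-- ★★ **THE TEN-LEAF RECORD CONE FOR EVERY WEIGHT SYSTEM**: `ChargeRecount · IP_G · FCP_G · CCP_G · REG-BALL_W · LABEL_W ·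
SHELL-BUDGET_W(10⁵) · HARM-TRANSFER♭(1/(3·10⁶)) · HARM-REDUCTION_W · P_G ⟹ ChargedEnergyGap` at the record dials, any `ϱ`, any `W`. -/
theorem chargedEnergyGap_of_harmonicLedger {ϱ : ℝ} (W : CoreWeights (3 / 20) (1 / 10) (6 / 5) 10 (1 / 100) 40 (1 / 10) 40 ϱ)
    (hF : ChargeRecount)
    (hIP : ImprovablePricingG (3 / 20) (1 / 10) (6 / 5) 10 (1 / 100) (3 / 5))
    (hFCP : FrustratedCorePricingG (3 / 20) (1 / 10) (6 / 5) 10 (1 / 100) 40 (3 / 5))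
    (hCCP : CoherentCorePricingG (3 / 20) (1 / 10) (6 / 5) 10 (1 / 100) 40 (1 / 10) 40 (3 / 5))
    (hB : CoreBallRegularPricingW W (1 / 20) (3 / 5) 10 fun _ _ => True)
    (hLab : CleanLabellingW W (3 / 5) 10 (1 / 3) 3)
    (hSB : ShellBudgetW W (3 / 5) 100000)
    (hH : HarmonicTransferBoundC (3 / 5) (1 / 3) 3 (1 / 100) (3 / 100) (1 / 2) ϱ (1 / 3000000))
    (hN : HarmonicReductionW (3 / 5) (1 / 3) 3 (1 / 100) (3 / 100) (1 / 2) ϱ (1 / 3000000) W (1 / 20) 10 100000)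
    (hP : ChartedChargePricingG (3 / 20) (1 / 10) (3 / 5)) : ChargedEnergyGap :=
  chargedEnergyGap_of_budgetLedger W hF hIP hFCP hCCP hB hLab hSB (farLabelledFloorCoredBudgetW_of_harmonic hH hN) hP

/-- ★★ **THE MAX-COVER TEN-LEAF RECORD CONE** at `ϱ = 160` (cone-designate pending census C11/C13): `ChargeRecount · IP_G · FCP_G · CCP_G ·
REG-BALL_M · LABEL_M · SHELL-BUDGET_M(10⁵) · HARM-TRANSFER♭(1/(3·10⁶)) · HARM-REDUCTION_M · P_G ⟹ ChargedEnergyGap`. -/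
theorem chargedEnergyGap_of_maxCoverHarmonicLedger_record (hF : ChargeRecount)
    (hIP : ImprovablePricingG (3 / 20) (1 / 10) (6 / 5) 10 (1 / 100) (3 / 5))
    (hFCP : FrustratedCorePricingG (3 / 20) (1 / 10) (6 / 5) 10 (1 / 100) 40 (3 / 5))
    (hCCP : CoherentCorePricingG (3 / 20) (1 / 10) (6 / 5) 10 (1 / 100) 40 (1 / 10) 40 (3 / 5))
    (hB : CoreBallRegularPricingW (maxCoverWeights (3 / 20) (1 / 10) (6 / 5) 10 (1 / 100) 40 (1 / 10) 40 160) (1 / 20) (3 / 5) 10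
      fun _ _ => True)
    (hLab : CleanLabellingW (maxCoverWeights (3 / 20) (1 / 10) (6 / 5) 10 (1 / 100) 40 (1 / 10) 40 160) (3 / 5) 10 (1 / 3) 3)
    (hSB : ShellBudgetW (maxCoverWeights (3 / 20) (1 / 10) (6 / 5) 10 (1 / 100) 40 (1 / 10) 40 160) (3 / 5) 100000)
    (hH : HarmonicTransferBoundC (3 / 5) (1 / 3) 3 (1 / 100) (3 / 100) (1 / 2) 160 (1 / 3000000))
    (hN : HarmonicReductionW (3 / 5) (1 / 3) 3 (1 / 100) (3 / 100) (1 / 2) 160 (1 / 3000000)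
      (maxCoverWeights (3 / 20) (1 / 10) (6 / 5) 10 (1 / 100) 40 (1 / 10) 40 160) (1 / 20) 10 100000)
    (hP : ChartedChargePricingG (3 / 20) (1 / 10) (3 / 5)) : ChargedEnergyGap :=
  chargedEnergyGap_of_maxCoverBudgetLedger_record hF hIP hFCP hCCP hB hLab hSB (farLabelledFloorCoredBudgetW_of_harmonic hH hN) hP

end Record

end Summit.AtomisticToContinuum.Crystallization.Theorems.ChargedEnergyGapChartDial

end

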